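import Summits.CriticalPhenomena.CardyFormulaZ2.Theorems.CardyComplexConeParafermionToSLESixFamiliesDiamondTurnCountFrame
import Literature.Probability.LatticeModels.MedialExplorationVertexEscapeB
import HarnessLib

/-!
# The escape staircase of a touch site, VIII: the two gadgets at the start edge
# (line `potential-darboux-picard-diamond`, S1t `stub_freeSideTurnCount`, part 12)

Crux `ParafermionToSLESixFamilies` (stmt-CriticalPhenomena-11389), line `potential-darboux-picard-diamond`, stub
`stub_freeSideTurnCount` (S1t). The escape path of a touch site enters the start corner `(x₀, k₀)` from the outer corner `p⋆`
of the face across the start edge `{x₀, x₀ + u_{k₀}}`, in one of two ways according to which outer corner is outside the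
diamond: GADGET 1, `p⋆ = x₀ + u_{k₀+3}`: one step `k₀ + 1` into `x₀` and the escape is completed by the corner
`(x₀, k₀ + 3)` (`turnCount_eq_of_vertexEscape_side`, value `-4 - (walkTurns + 1)`); GADGET 2,
`p⋆ = x₀ + u_{k₀+3} + u_{k₀}`: steps `k₀ + 1` onto the `B`-end `x₀ + u_{k₀}` of the start edge and `k₀ + 2` along it into
`x₀` (`turnCount_eq_of_vertexEscapeB_side`, value `-4 - walkTurns`). `gadget_data` (registered) packages both as one
interface: the gadget steps `gds`, the offset `g ∈ {1, 0}`, their bookkeeping, and the resulting turn-count theorem for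
every vertex path ending with `gds`.
-/

noncomputable section

namespace Summit.CriticalPhenomena.CardyFormulaZ2.Cruxes.ParafermionToSLESixFamilies.PotentialDarbouxPicardDiamond

open Literature.Probability Literature.Probability.LatticeModels Literature.Probability.Percolation
open Literature.Probability.LatticeModels.DiscreteDobrushin

/-- One lattice step changes each frame coordinate by at most one. -/
theorem abs_frame_sub_le_one_of_step (k m : Fin 4) (v : Site 2) :
    |xiC k (v + cornerUnit m) - xiC k v| ≤ 1 ∧ |upC k (v + cornerUnit m) - upC k v| ≤ 1 := by
  rw [abs_le, abs_le]
  fin_cases k <;> fin_cases m <;> simp [xiC, upC, cornerUnit]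

/-- Two perpendicular lattice steps change each frame coordinate by at most one. -/
theorem abs_frame_sub_le_one_of_two_steps (k m : Fin 4) (v : Site 2) :
    |xiC k (v + cornerUnit m + cornerUnit (m + 1)) - xiC k v| ≤ 1 ∧ |upC k (v + cornerUnit m + cornerUnit (m + 1)) - upC k v| ≤ 1 := by
  rw [abs_le, abs_le]
  fin_cases k <;> fin_cases m <;> simp [xiC, upC, cornerUnit]

/-- **The two gadgets at the start edge** (registered helper of `stub_freeSideTurnCount`). See the module docstring. -/
theorem gadget_data : ∀ (E : DiscreteDobrushin) (hE : E.IsZdAdmissible) (k : Fin 4) (ps : Site 2), (ps = (startCorner hE).1 + cornerUnit ((startCorner hE).2 + 3) ∨ ps = (startCorner hE).1 + cornerUnit ((startCorner hE).2 + 3) + cornerUnit (startCorner hE).2) → ∃ (gds : List (Fin 4)) (g : ℤ), gds ≠ [] ∧ pathEnd ps gds = (startCorner hE).1 ∧ (∀ v ∈ pathVerts ps gds, v = ps ∨ v = (startCorner hE).1 + cornerUnit (startCorner hE).2) ∧ (pathVerts ps gds).Nodup ∧ (startCorner hE).1 ∉ pathVerts ps gds ∧ (|xiC k (startCorner hE).1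 - xiC k ps| ≤ 1 ∧ |upC k (startCorner hE).1 - upC k ps| ≤ 1) ∧ (∀ v ∈ pathVerts ps gds, |xiC k v - xiC k ps| ≤ 1 ∧ |upC k v - upC k ps| ≤ 1) ∧ (∀ (u : Site 2) (j : Fin 4) (ds : List (Fin 4)) (d : Site 2 × Fin 4) (S : ℤ), ds.head? = some (j + 1) → 2 ≤ ds.length → pathEnd u ds = (startCorner hE).1 → lastDir ds = lastDir gds → (∀ v ∈ (pathVerts u ds).tail, (∀ i : Fin 4, ¬ E.IsInnerFace (faceAt v i)) ∨ v ∈ E.zdArcB) → (pathVerts u ds ++ [(startCorner hE).1]).Nodup → d ∈ cornerWalk u j ds → d.2 = j + 3 → (∀ p' : Site 2 × Fin 4, E.IsInnerFace (cFace p') → sideVal j (cpos p') ≤ S) → (∀ d' ∈ cornerWalk u j ds, sideVal j (cpos d') ≤ S) → sideVal j (cpos ((startCorner hE).1, (startCorner hE).2 + 3)) ≤ S → sideVal j (cpos d) = S → ∀ (ω : BondConfig (Site 2)) (t : ℕ), t < exitTime hE ω → cornerOrbit (E.bcBondConfig ω) (startCorner hE) t = (u, j) → turnCount (E.bcBondConfig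 ω) (startCorner hE) t = -4 - (walkTurns j ds + g)) := by
  intro E hE k ps hps
  have cornerUnit_add_three_add_one : ∀ k : Fin 4, cornerUnit (k + 3) + cornerUnit (k + 1) = 0 := by decide
  have cornerUnit_add_add_two : ∀ k : Fin 4, cornerUnit k + cornerUnit (k + 2) = 0 := by decide
  set x₀ := (startCorner hE).1 with hx₀
  set k₀ := (startCorner hE).2 with hk₀
  rcases hps with hps | hps
  · -- GADGET 1: one step `k₀ + 1` into `x₀`, completed by the corner `(x₀, k₀ + 3)`
    have hend : pathEnd ps [k₀ + 1] = x₀ := by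
      rw [pathEnd_cons, hps, add_assoc, cornerUnit_add_three_add_one, add_zero]; rfl
    have hne : x₀ ≠ ps := by
      intro h
      have := congrArg (fun w => w - x₀) h
      simp only [hps, sub_self, add_sub_cancel_left] at this
      exact cornerUnit_ne_zero _ this.symm
    refine ⟨[k₀ + 1], 1, List.cons_ne_nil _ _, hend, ?_, ?_, ?_, ?_, ?_, ?_⟩
    · intro v hv; simp [pathVerts] at hv; exact Or.inl hv
    · simp [pathVerts]
    · simp [pathVerts]; exact hne
    · have := abs_frame_sub_le_one_of_step k (k₀ + 3) x₀
      rw [← hps] at this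
      rw [abs_sub_comm, abs_sub_comm (upC k x₀)]; exact this
    · intro v hv; simp [pathVerts] at hv; subst hv; simp
    · intro u j ds d S hhead _ hdsend hlast hforb hnodup hd hidx hI hEc hx hdS ω t ht horb
      rw [lastDir_singleton] at hlast
      have hd' : d ∈ escapeList hE u j ds := List.mem_append_left _ hd
      have hI' : ∀ p : Site 2 × Fin 4, E.IsInnerFace (cFace p) → sideVal j (cpos p) ≤ sideVal j (cpos d) :=
        fun p hp => hdS ▸ hI p hp
      have hE' : ∀ d' ∈ escapeList hE u j ds, sideVal j (cpos d') ≤ sideVal j (cpos d) := by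
        intro d' hd'
        rw [escapeList, List.mem_append, List.mem_singleton] at hd'
        rw [hdS]
        rcases hd' with h | rfl
        · exact hEc d' h
        · exact hx
      exact turnCount_eq_of_vertexEscape_side hE hhead hdsend hlast hforb hnodup hd' hidx hI' hE' ω ht horb
  · -- GADGET 2: step `k₀ + 1` onto the `B`-end, then `k₀ + 2` along the start edge into `x₀`
    have hb : ps + cornerUnit (k₀ + 1) = x₀ + cornerUnit k₀ := by
      rw [hps, add_assoc, add_assoc, add_comm (cornerUnit k₀), ← add_assoc (cornerUnit (k₀ + 3)), cornerUnit_add_three_add_one,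
        zero_add]
    have hend : pathEnd ps [k₀ + 1, k₀ + 2] = x₀ := by
      rw [pathEnd_cons, pathEnd_cons, hb, add_assoc, cornerUnit_add_add_two, add_zero]; rfl
    have hverts : pathVerts ps [k₀ + 1, k₀ + 2] = [ps, x₀ + cornerUnit k₀] := by
      rw [pathVerts_cons, pathVerts_cons, hb]; rfl
    have hne1 : x₀ ≠ ps := by
      intro h
      have := congrArg (xiC k₀) (h.trans hps)
      simp only [xiC_add_unit0, xiC_add_unit3] at this
      omega
    have hne2 : x₀ ≠ x₀ + cornerUnit k₀ := by
      intro h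
      have := congrArg (xiC k₀) h
      simp only [xiC_add_unit0] at this
      omega
    have hne3 : ps ≠ x₀ + cornerUnit k₀ := by
      intro h
      have := congrArg (upC k₀) (hps.symm.trans h)
      simp only [upC_add_unit0, upC_add_unit3] at this
      omega
    refine ⟨[k₀ + 1, k₀ + 2], 0, List.cons_ne_nil _ _, hend, ?_, ?_, ?_, ?_, ?_, ?_⟩
    · intro v hv
      rw [hverts] at hv
      simp at hv
      exact hv
    · rw [hverts]; simp [hne3]
    · rw [hverts]; simp [hne1, hne2]
    · have := abs_frame_sub_le_one_of_two_steps k (k₀ + 3) x₀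
      rw [(fin4_escape_arith k₀).1, ← hps] at this
      rw [abs_sub_comm, abs_sub_comm (upC k x₀)]; exact this
    · intro v hv
      rw [hverts] at hv
      simp at hv
      rcases hv with rfl | rfl
      · simp
      · rw [← hb]; exact abs_frame_sub_le_one_of_step k (k₀ + 1) ps
    · intro u j ds d S hhead hlen hdsend hlast hforb hnodup hd hidx hI hEc _ hdS ω t ht horb
      rw [lastDir_cons_cons, lastDir_singleton] at hlast
      have hI' : ∀ p : Site 2 × Fin 4, E.IsInnerFace (cFace p) → sideVal j (cpos p) ≤ sideVal j (cpos d) :=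
        fun p hp => hdS ▸ hI p hp
      have hE' : ∀ d' ∈ cornerWalk u j ds, sideVal j (cpos d') ≤ sideVal j (cpos d) := fun d' h => hdS ▸ hEc d' h
      rw [add_zero]
      exact turnCount_eq_of_vertexEscapeB_side hE hhead hlen hdsend hlast hforb (List.nodup_append.1 hnodup).1 hd hidx hI' hE'
        ω ht horb

end Summit.CriticalPhenomena.CardyFormulaZ2.Cruxes.ParafermionToSLESixFamilies.PotentialDarbouxPicardDiamond

end
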